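import Summits.Ventures.PercRepro2.CaseOnePairPocketForms
import Summits.Ventures.PercRepro2.CaseOneMovesAnchors

/-!
# The second pocket reduction: two special vertices in a mark-free-otherwise pocket
(blind cell PercRepro2, p1 g27)

With the roots outside the pocket and each of `o, a₃, b` outside or one of the two designated vertices
`z₁, z₂`, every case-1 quantity at `a₃` is the same in `G` and in the tree gadget
`pairEnds ends P e₁ e₂ e₃ x w z₁ z₂` under `pairW` (`Dpd_pair`, …, `iExprT_pair`, the Series pattern
with the skeleton events): **`fourForms_pair_iff`**, **`closedAt_of_pair`**. With `z₁ = a₃` and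
`z₂ = o` at a ROOT cut vertex the gadget is «`a₃` pendant at the hub `w ~ {root, o}`», a roots-and-`o`
anchor after the leaf is deleted, so the class is CLOSED unconditionally: **`closedAt_of_pair_at_root`**
— a statement vertex and the mark `o` in a common pocket hanging at a root, the pocket otherwise
mark-free, have the four case-1 forms for every weight vector. Own code; standard axioms. -/

namespace Summit.Ventures.PercRepro2

namespace CaseOne

universe u

section PairTransfer
variable {V : Type*} {E : Type*} [Fintype E] [DecidableEq E] {R : Type*} [Field R] [LinearOrder R]
  [IsStrictOrderedRing R]
variable {ends : E → Sym2 V} {W : Set V} {x : V} {P : Finset E} {e₁ e₂ e₃ : E} {w z₁ z₂ : V}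
  {o a₁ a₂ a₃ b : V} {p : E → R} (hp : IsProbVec p) (hh : IsPairPocket ends W x P e₁ e₂ e₃ w z₁ z₂)
  (h1 : a₁ ∉ W) (h2 : a₂ ∉ W) (ho : o ∉ W ∨ o = z₁ ∨ o = z₂) (ha : a₃ ∉ W ∨ a₃ = z₁ ∨ a₃ = z₂)
  (hb : b ∉ W ∨ b = z₁ ∨ b = z₂)

include hp hh h1 h2

/-- `D` transfers to the gadget. -/
theorem Dpd_pair (ha : a₃ ∉ W ∨ a₃ = z₁ ∨ a₃ = z₂) :
    Dpd p ends a₁ a₂ a₃ = Dpd (pairW p ends P e₁ e₂ e₃ x z₁ z₂) (pairEnds ends P e₁ e₂ e₃ x w z₁ z₂)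
      a₁ a₂ a₃ := by
  have E1 : ∀ {u v : V}, (u ∉ W ∨ u = z₁ ∨ u = z₂) → (v ∉ W ∨ v = z₁ ∨ v = z₂) →
      (u = v ∨ u ∉ W ∨ v ∉ W) →
      connEvent ends u v = pairΘ ends P x z₁ z₂ ⁻¹' skelSet ends x z₁ z₂ u v :=
    fun hu hv hsep => connEvent_pair_skel hh.pocket hh.mem_z₁ hh.mem_z₂ hh.ne_z hu hv hsep
  have E2 : ∀ {u v : V}, (u ∉ W ∨ u = z₁ ∨ u = z₂) → (v ∉ W ∨ v = z₁ ∨ v = z₂) →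
      (u = v ∨ u ∉ W ∨ v ∉ W) →
      connEvent (pairEnds ends P e₁ e₂ e₃ x w z₁ z₂) u v =
        pairΘ' P e₁ e₂ e₃ ⁻¹' skelSet ends x z₁ z₂ u v :=
    fun hu hv hsep => connEvent_pairEnds_skel hh hu hv hsep
  unfold Dpd
  rw [E1 (Or.inl h1) ha (Or.inr (Or.inl h1)), E1 (Or.inl h2) ha (Or.inr (Or.inl h2)),
    E1 (Or.inl h1) (Or.inl h2) (Or.inr (Or.inl h1)), E2 (Or.inl h1) ha (Or.inr (Or.inl h1)),
    E2 (Or.inl h2) ha (Or.inr (Or.inl h2)), E2 (Or.inl h1) (Or.inl h2) (Or.inr (Or.inl h1))]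
  simp only [← Set.preimage_compl, ← Set.preimage_inter,
    prob_pair_skel ends P x z₁ z₂ hp hh.mem₁ hh.mem₂ hh.mem₃ hh.ne₁₂ hh.ne₁₃ hh.ne₂₃]

/-- `D_o` transfers to the gadget. -/
theorem Dpdo_pair (ho : o ∉ W ∨ o = z₁ ∨ o = z₂) (ha : a₃ ∉ W ∨ a₃ = z₁ ∨ a₃ = z₂) :
    Dpdo p ends o a₁ a₂ a₃ =
      Dpdo (pairW p ends P e₁ e₂ e₃ x z₁ z₂) (pairEnds ends P e₁ e₂ e₃ x w z₁ z₂) o a₁ a₂ a₃ := by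
  have E1 : ∀ {u v : V}, (u ∉ W ∨ u = z₁ ∨ u = z₂) → (v ∉ W ∨ v = z₁ ∨ v = z₂) →
      (u = v ∨ u ∉ W ∨ v ∉ W) →
      connEvent ends u v = pairΘ ends P x z₁ z₂ ⁻¹' skelSet ends x z₁ z₂ u v :=
    fun hu hv hsep => connEvent_pair_skel hh.pocket hh.mem_z₁ hh.mem_z₂ hh.ne_z hu hv hsep
  have E2 : ∀ {u v : V}, (u ∉ W ∨ u = z₁ ∨ u = z₂) → (v ∉ W ∨ v = z₁ ∨ v = z₂) →
      (u = v ∨ u ∉ W ∨ v ∉ W) →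
      connEvent (pairEnds ends P e₁ e₂ e₃ x w z₁ z₂) u v =
        pairΘ' P e₁ e₂ e₃ ⁻¹' skelSet ends x z₁ z₂ u v :=
    fun hu hv hsep => connEvent_pairEnds_skel hh hu hv hsep
  unfold Dpdo
  rw [E1 (Or.inl h1) ho (Or.inr (Or.inl h1)), E1 (Or.inl h2) ho (Or.inr (Or.inl h2)),
    E1 (Or.inl h1) ha (Or.inr (Or.inl h1)), E1 (Or.inl h2) ha (Or.inr (Or.inl h2)),
    E1 (Or.inl h1) (Or.inl h2) (Or.inr (Or.inl h1)), E2 (Or.inl h1) ho (Or.inr (Or.inl h1)),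
    E2 (Or.inl h2) ho (Or.inr (Or.inl h2)), E2 (Or.inl h1) ha (Or.inr (Or.inl h1)),
    E2 (Or.inl h2) ha (Or.inr (Or.inl h2)), E2 (Or.inl h1) (Or.inl h2) (Or.inr (Or.inl h1))]
  simp only [← Set.preimage_compl, ← Set.preimage_inter, ← Set.preimage_union,
    prob_pair_skel ends P x z₁ z₂ hp hh.mem₁ hh.mem₂ hh.mem₃ hh.ne₁₂ hh.ne₁₃ hh.ne₂₃]

/-- `P(Q, o ∈ U)` transfers to the gadget. -/
theorem Dqo_pair (ho : o ∉ W ∨ o = z₁ ∨ o = z₂) :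
    Dqo p ends o a₁ a₂ =
      Dqo (pairW p ends P e₁ e₂ e₃ x z₁ z₂) (pairEnds ends P e₁ e₂ e₃ x w z₁ z₂) o a₁ a₂ := by
  have E1 : ∀ {u v : V}, (u ∉ W ∨ u = z₁ ∨ u = z₂) → (v ∉ W ∨ v = z₁ ∨ v = z₂) →
      (u = v ∨ u ∉ W ∨ v ∉ W) →
      connEvent ends u v = pairΘ ends P x z₁ z₂ ⁻¹' skelSet ends x z₁ z₂ u v :=
    fun hu hv hsep => connEvent_pair_skel hh.pocket hh.mem_z₁ hh.mem_z₂ hh.ne_z hu hv hsep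
  have E2 : ∀ {u v : V}, (u ∉ W ∨ u = z₁ ∨ u = z₂) → (v ∉ W ∨ v = z₁ ∨ v = z₂) →
      (u = v ∨ u ∉ W ∨ v ∉ W) →
      connEvent (pairEnds ends P e₁ e₂ e₃ x w z₁ z₂) u v =
        pairΘ' P e₁ e₂ e₃ ⁻¹' skelSet ends x z₁ z₂ u v :=
    fun hu hv hsep => connEvent_pairEnds_skel hh hu hv hsep
  unfold Dqo
  rw [E1 (Or.inl h1) ho (Or.inr (Or.inl h1)), E1 (Or.inl h2) ho (Or.inr (Or.inl h2)),
    E1 (Or.inl h1) (Or.inl h2) (Or.inr (Or.inl h1)), E2 (Or.inl h1) ho (Or.inr (Or.inl h1)),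
    E2 (Or.inl h2) ho (Or.inr (Or.inl h2)), E2 (Or.inl h1) (Or.inl h2) (Or.inr (Or.inl h1))]
  simp only [← Set.preimage_compl, ← Set.preimage_inter, ← Set.preimage_union,
    prob_pair_skel ends P x z₁ z₂ hp hh.mem₁ hh.mem₂ hh.mem₃ hh.ne₁₂ hh.ne₁₃ hh.ne₂₃]

/-- `P(Q)` transfers to the gadget. -/
theorem probQ_pair :
    prob p (connEvent ends a₁ a₂)ᶜ =
      prob (pairW p ends P e₁ e₂ e₃ x z₁ z₂) (connEvent (pairEnds ends P e₁ e₂ e₃ x w z₁ z₂) a₁ a₂)ᶜ := by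
  have E1 : ∀ {u v : V}, (u ∉ W ∨ u = z₁ ∨ u = z₂) → (v ∉ W ∨ v = z₁ ∨ v = z₂) →
      (u = v ∨ u ∉ W ∨ v ∉ W) →
      connEvent ends u v = pairΘ ends P x z₁ z₂ ⁻¹' skelSet ends x z₁ z₂ u v :=
    fun hu hv hsep => connEvent_pair_skel hh.pocket hh.mem_z₁ hh.mem_z₂ hh.ne_z hu hv hsep
  have E2 : ∀ {u v : V}, (u ∉ W ∨ u = z₁ ∨ u = z₂) → (v ∉ W ∨ v = z₁ ∨ v = z₂) →
      (u = v ∨ u ∉ W ∨ v ∉ W) →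
      connEvent (pairEnds ends P e₁ e₂ e₃ x w z₁ z₂) u v =
        pairΘ' P e₁ e₂ e₃ ⁻¹' skelSet ends x z₁ z₂ u v :=
    fun hu hv hsep => connEvent_pairEnds_skel hh hu hv hsep
  rw [E1 (Or.inl h1) (Or.inl h2) (Or.inr (Or.inl h1)), E2 (Or.inl h1) (Or.inl h2) (Or.inr (Or.inl h1)),
    ← Set.preimage_compl, ← Set.preimage_compl,
    prob_pair_skel ends P x z₁ z₂ hp hh.mem₁ hh.mem₂ hh.mem₃ hh.ne₁₂ hh.ne₁₃ hh.ne₂₃]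

include ho ha hb

/-- **`iiExpr` transfers to the gadget.** -/
theorem iiExpr_pair :
    iiExpr p ends o a₁ a₂ a₃ b =
      iiExpr (pairW p ends P e₁ e₂ e₃ x z₁ z₂) (pairEnds ends P e₁ e₂ e₃ x w z₁ z₂) o a₁ a₂ a₃ b := by
  have E1 : ∀ {u v : V}, (u ∉ W ∨ u = z₁ ∨ u = z₂) → (v ∉ W ∨ v = z₁ ∨ v = z₂) →
      (u = v ∨ u ∉ W ∨ v ∉ W) →
      connEvent ends u v = pairΘ ends P x z₁ z₂ ⁻¹' skelSet ends x z₁ z₂ u v :=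
    fun hu hv hsep => connEvent_pair_skel hh.pocket hh.mem_z₁ hh.mem_z₂ hh.ne_z hu hv hsep
  have E2 : ∀ {u v : V}, (u ∉ W ∨ u = z₁ ∨ u = z₂) → (v ∉ W ∨ v = z₁ ∨ v = z₂) →
      (u = v ∨ u ∉ W ∨ v ∉ W) →
      connEvent (pairEnds ends P e₁ e₂ e₃ x w z₁ z₂) u v =
        pairΘ' P e₁ e₂ e₃ ⁻¹' skelSet ends x z₁ z₂ u v :=
    fun hu hv hsep => connEvent_pairEnds_skel hh hu hv hsep
  rw [iiExpr_eq_probs, iiExpr_eq_probs, Dpd_pair hp hh h1 h2 ha, Dpdo_pair hp hh h1 h2 ho ha]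
  rw [E1 (Or.inl h2) hb (Or.inr (Or.inl h2)), E1 (Or.inl h1) ha (Or.inr (Or.inl h1)),
    E1 (Or.inl h2) ho (Or.inr (Or.inl h2)), E1 (Or.inl h1) (Or.inl h2) (Or.inr (Or.inl h1)),
    E2 (Or.inl h2) hb (Or.inr (Or.inl h2)), E2 (Or.inl h1) ha (Or.inr (Or.inl h1)),
    E2 (Or.inl h2) ho (Or.inr (Or.inl h2)), E2 (Or.inl h1) (Or.inl h2) (Or.inr (Or.inl h1))]
  simp only [← Set.preimage_compl, ← Set.preimage_inter,
    prob_pair_skel ends P x z₁ z₂ hp hh.mem₁ hh.mem₂ hh.mem₃ hh.ne₁₂ hh.ne₁₃ hh.ne₂₃]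

/-- **`iExpr` transfers to the gadget.** -/
theorem iExpr_pair :
    iExpr p ends o a₁ a₂ a₃ b =
      iExpr (pairW p ends P e₁ e₂ e₃ x z₁ z₂) (pairEnds ends P e₁ e₂ e₃ x w z₁ z₂) o a₁ a₂ a₃ b := by
  have E1 : ∀ {u v : V}, (u ∉ W ∨ u = z₁ ∨ u = z₂) → (v ∉ W ∨ v = z₁ ∨ v = z₂) →
      (u = v ∨ u ∉ W ∨ v ∉ W) →
      connEvent ends u v = pairΘ ends P x z₁ z₂ ⁻¹' skelSet ends x z₁ z₂ u v :=
    fun hu hv hsep => connEvent_pair_skel hh.pocket hh.mem_z₁ hh.mem_z₂ hh.ne_z hu hv hsep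
  have E2 : ∀ {u v : V}, (u ∉ W ∨ u = z₁ ∨ u = z₂) → (v ∉ W ∨ v = z₁ ∨ v = z₂) →
      (u = v ∨ u ∉ W ∨ v ∉ W) →
      connEvent (pairEnds ends P e₁ e₂ e₃ x w z₁ z₂) u v =
        pairΘ' P e₁ e₂ e₃ ⁻¹' skelSet ends x z₁ z₂ u v :=
    fun hu hv hsep => connEvent_pairEnds_skel hh hu hv hsep
  rw [iExpr_eq_iExprT, iExpr_eq_iExprT, iExprT_eq, iExprT_eq, Dpd_pair hp hh h1 h2 ha,
    Dpdo_pair hp hh h1 h2 ho ha]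
  rw [E1 (Or.inl h1) hb (Or.inr (Or.inl h1)), E1 (Or.inl h1) ha (Or.inr (Or.inl h1)),
    E1 (Or.inl h2) ho (Or.inr (Or.inl h2)), E1 (Or.inl h1) (Or.inl h2) (Or.inr (Or.inl h1)),
    E2 (Or.inl h1) hb (Or.inr (Or.inl h1)), E2 (Or.inl h1) ha (Or.inr (Or.inl h1)),
    E2 (Or.inl h2) ho (Or.inr (Or.inl h2)), E2 (Or.inl h1) (Or.inl h2) (Or.inr (Or.inl h1))]
  simp only [← Set.preimage_compl, ← Set.preimage_inter,
    prob_pair_skel ends P x z₁ z₂ hp hh.mem₁ hh.mem₂ hh.mem₃ hh.ne₁₂ hh.ne₁₃ hh.ne₂₃]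

/-- **`iiExprT` transfers to the gadget** (any threshold pair). -/
theorem iiExprT_pair (c₀ c₁ : R) :
    iiExprT p ends o a₁ a₂ a₃ b c₀ c₁ =
      iiExprT (pairW p ends P e₁ e₂ e₃ x z₁ z₂) (pairEnds ends P e₁ e₂ e₃ x w z₁ z₂) o a₁ a₂ a₃ b
        c₀ c₁ := by
  have E1 : ∀ {u v : V}, (u ∉ W ∨ u = z₁ ∨ u = z₂) → (v ∉ W ∨ v = z₁ ∨ v = z₂) →
      (u = v ∨ u ∉ W ∨ v ∉ W) →
      connEvent ends u v = pairΘ ends P x z₁ z₂ ⁻¹' skelSet ends x z₁ z₂ u v :=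
    fun hu hv hsep => connEvent_pair_skel hh.pocket hh.mem_z₁ hh.mem_z₂ hh.ne_z hu hv hsep
  have E2 : ∀ {u v : V}, (u ∉ W ∨ u = z₁ ∨ u = z₂) → (v ∉ W ∨ v = z₁ ∨ v = z₂) →
      (u = v ∨ u ∉ W ∨ v ∉ W) →
      connEvent (pairEnds ends P e₁ e₂ e₃ x w z₁ z₂) u v =
        pairΘ' P e₁ e₂ e₃ ⁻¹' skelSet ends x z₁ z₂ u v :=
    fun hu hv hsep => connEvent_pairEnds_skel hh hu hv hsep
  rw [iiExprT_eq, iiExprT_eq]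
  rw [E1 (Or.inl h2) hb (Or.inr (Or.inl h2)), E1 (Or.inl h1) ha (Or.inr (Or.inl h1)),
    E1 (Or.inl h2) ho (Or.inr (Or.inl h2)), E1 (Or.inl h1) (Or.inl h2) (Or.inr (Or.inl h1)),
    E2 (Or.inl h2) hb (Or.inr (Or.inl h2)), E2 (Or.inl h1) ha (Or.inr (Or.inl h1)),
    E2 (Or.inl h2) ho (Or.inr (Or.inl h2)), E2 (Or.inl h1) (Or.inl h2) (Or.inr (Or.inl h1))]
  simp only [← Set.preimage_compl, ← Set.preimage_inter,
    prob_pair_skel ends P x z₁ z₂ hp hh.mem₁ hh.mem₂ hh.mem₃ hh.ne₁₂ hh.ne₁₃ hh.ne₂₃]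

/-- **`iExprT` transfers to the gadget** (any threshold pair). -/
theorem iExprT_pair (c₀ c₁ : R) :
    iExprT p ends o a₁ a₂ a₃ b c₀ c₁ =
      iExprT (pairW p ends P e₁ e₂ e₃ x z₁ z₂) (pairEnds ends P e₁ e₂ e₃ x w z₁ z₂) o a₁ a₂ a₃ b
        c₀ c₁ := by
  have E1 : ∀ {u v : V}, (u ∉ W ∨ u = z₁ ∨ u = z₂) → (v ∉ W ∨ v = z₁ ∨ v = z₂) →
      (u = v ∨ u ∉ W ∨ v ∉ W) →
      connEvent ends u v = pairΘ ends P x z₁ z₂ ⁻¹' skelSet ends x z₁ z₂ u v :=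
    fun hu hv hsep => connEvent_pair_skel hh.pocket hh.mem_z₁ hh.mem_z₂ hh.ne_z hu hv hsep
  have E2 : ∀ {u v : V}, (u ∉ W ∨ u = z₁ ∨ u = z₂) → (v ∉ W ∨ v = z₁ ∨ v = z₂) →
      (u = v ∨ u ∉ W ∨ v ∉ W) →
      connEvent (pairEnds ends P e₁ e₂ e₃ x w z₁ z₂) u v =
        pairΘ' P e₁ e₂ e₃ ⁻¹' skelSet ends x z₁ z₂ u v :=
    fun hu hv hsep => connEvent_pairEnds_skel hh hu hv hsep
  rw [iExprT_eq, iExprT_eq]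
  rw [E1 (Or.inl h1) hb (Or.inr (Or.inl h1)), E1 (Or.inl h1) ha (Or.inr (Or.inl h1)),
    E1 (Or.inl h2) ho (Or.inr (Or.inl h2)), E1 (Or.inl h1) (Or.inl h2) (Or.inr (Or.inl h1)),
    E2 (Or.inl h1) hb (Or.inr (Or.inl h1)), E2 (Or.inl h1) ha (Or.inr (Or.inl h1)),
    E2 (Or.inl h2) ho (Or.inr (Or.inl h2)), E2 (Or.inl h1) (Or.inl h2) (Or.inr (Or.inl h1))]
  simp only [← Set.preimage_compl, ← Set.preimage_inter,
    prob_pair_skel ends P x z₁ z₂ hp hh.mem₁ hh.mem₂ hh.mem₃ hh.ne₁₂ hh.ne₁₃ hh.ne₂₃]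

/-- **The four forms at `a₃` are the same in `G` and in the tree gadget.** -/
theorem fourForms_pair_iff :
    FourForms p ends o a₁ a₂ a₃ b ↔
      FourForms (pairW p ends P e₁ e₂ e₃ x z₁ z₂) (pairEnds ends P e₁ e₂ e₃ x w z₁ z₂) o a₁ a₂ a₃ b := by
  unfold FourForms ZSplitII ZSplitIIQ ZSplitI ZSplitIQ
  rw [iiExpr_pair hp hh h1 h2 ho ha hb, iExpr_pair hp hh h1 h2 ho ha hb,
    iiExprT_pair hp hh h1 h2 ho ha hb, iExprT_pair hp hh h1 h2 ho ha hb, Dqo_pair hp hh h1 h2 ho,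
    probQ_pair hp hh h1 h2]

end PairTransfer

section PairTheorem
variable {V : Type*} {E : Type*} [Fintype E] [DecidableEq E] {R : Type*} [Field R] [LinearOrder R]
  [IsStrictOrderedRing R]
variable {ends : E → Sym2 V} {W : Set V} {x : V} {P : Finset E} {e₁ e₂ e₃ : E} {w z₁ z₂ : V}
  {o a₁ a₂ a₃ b : V}

/-- **The second pocket reduction**: `ClosedAt a₃` in the tree gadget gives `ClosedAt a₃` in `G`. -/
theorem closedAt_of_pair (hh : IsPairPocket ends W x P e₁ e₂ e₃ w z₁ z₂) (h1 : a₁ ∉ W) (h2 : a₂ ∉ W)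
    (ho : o ∉ W ∨ o = z₁ ∨ o = z₂) (ha : a₃ ∉ W ∨ a₃ = z₁ ∨ a₃ = z₂) (hb : b ∉ W ∨ b = z₁ ∨ b = z₂)
    (hc : ClosedAt R o a₁ a₂ b E (pairEnds ends P e₁ e₂ e₃ x w z₁ z₂) a₃) :
    ClosedAt R o a₁ a₂ b E ends a₃ :=
  fun p hp => (fourForms_pair_iff hp hh h1 h2 ho ha hb).2
    (hc (pairW p ends P e₁ e₂ e₃ x z₁ z₂) (IsProbVec.pairW hp ends P x z₁ z₂ e₁ e₂ e₃))

end PairTheorem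

section PairLeaf
variable {V : Type*} {E : Type u} [DecidableEq E]
variable {ends : E → Sym2 V} {W : Set V} {x : V} {P : Finset E} {e₁ e₂ e₃ : E} {w : V}
  {o a₁ a₂ a₃ b : V}

/-- In the gadget with `z₁ = a₃`, `a₃` is a leaf at the hub. -/
lemma IsPairPocket.isLeafAt_hub (hh : IsPairPocket ends W x P e₁ e₂ e₃ w a₃ o) :
    IsLeafAt (pairEnds ends P e₁ e₂ e₃ x w a₃ o) w a₃ e₂ where
  ends_eq := pairEnds_e₂ hh.ne₁₂
  unique := by
    intro e hmem
    by_contra hne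
    by_cases he1 : e = e₁
    · rw [he1, pairEnds_e₁, Sym2.mem_iff] at hmem
      rcases hmem with h | h
      · exact hh.pocket.x_not_mem (h ▸ hh.mem_z₁)
      · exact hh.hub_ne₁ h.symm
    by_cases he3 : e = e₃
    · rw [he3, pairEnds_e₃ hh.ne₁₃ hh.ne₂₃, Sym2.mem_iff] at hmem
      rcases hmem with h | h
      · exact hh.hub_ne₁ h.symm
      · exact hh.ne_z h
    by_cases heP : e ∈ P
    · rw [pairEnds_of_mem heP he1 hne he3, Sym2.mem_iff] at hmem
      rcases hmem with h | h <;> exact hh.pocket.x_not_mem (h ▸ hh.mem_z₁)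
    · rw [pairEnds_of_not_mem heP hh.mem₁ hh.mem₂ hh.mem₃] at hmem
      exact heP (hh.pocket.mem_P hh.mem_z₁ hmem)
  ne := hh.hub_ne₁

/-- In the gadget minus the leaf edge, the hub is a roots-and-`o` anchor when the cut vertex is a root. -/
lemma IsPairPocket.rootsAndOAnchor_hub (hh : IsPairPocket ends W x P e₁ e₂ e₃ w a₃ o)
    (hx : x = a₁ ∨ x = a₂) (h1 : a₁ ∉ W) (h2 : a₂ ∉ W) (hb : b ∉ W) :
    RootsAndOAnchor o a₁ a₂ b {e : E // e ≠ e₂} (restrictEnds (pairEnds ends P e₁ e₂ e₃ x w a₃ o) e₂)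
      w := by
  refine ⟨⟨e₃, hh.ne₂₃.symm⟩, ?_, ?_, hh.hub_ne₂.symm, fun h => h1 (h ▸ hh.hub),
    fun h => h2 (h ▸ hh.hub), fun h => hb (h ▸ hh.hub)⟩
  · simp only [restrictEnds]
    rw [pairEnds_e₃ hh.ne₁₃ hh.ne₂₃, Sym2.eq_swap]
  · intro e hmem hne
    simp only [restrictEnds] at hmem ⊢
    by_cases he1 : e.1 = e₁
    · rw [he1, pairEnds_e₁]
      rcases hx with rfl | rfl
      · exact Or.inl rfl
      · exact Or.inr rfl
    have he3 : e.1 ≠ e₃ := fun h => hne (Subtype.ext h)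
    by_cases heP : e.1 ∈ P
    · rw [pairEnds_of_mem heP he1 e.2 he3, Sym2.mem_iff] at hmem
      rcases hmem with h | h <;> exact absurd (h ▸ hh.hub) hh.pocket.x_not_mem
    · rw [pairEnds_of_not_mem heP hh.mem₁ hh.mem₂ hh.mem₃] at hmem
      exact absurd (hh.pocket.mem_P hh.hub hmem) heP

end PairLeaf

section PairRoot
variable {V : Type*} [Fintype V] [DecidableEq V] {R : Type*} [Field R] [LinearOrder R]
  [IsStrictOrderedRing R] {E : Type u} [Fintype E] [DecidableEq E]
variable {ends : E → Sym2 V} {W : Set V} {x : V} {P : Finset E} {e₁ e₂ e₃ : E} {w : V}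
  {o a₁ a₂ a₃ b : V}

/-- **A statement vertex and the mark `o` in a common pocket hanging at a root are closed**: the
pocket (W, x, P) contains `a₃` and `o` (and the hub `w`), the cut vertex `x` is a root, and `a₁, a₂, b`
are outside. -/
theorem closedAt_of_pair_at_root (hh : IsPairPocket ends W x P e₁ e₂ e₃ w a₃ o)
    (hx : x = a₁ ∨ x = a₂) (h1 : a₁ ∉ W) (h2 : a₂ ∉ W) (hb : b ∉ W) :
    ClosedAt R o a₁ a₂ b E ends a₃ := by
  refine closedAt_of_pair hh h1 h2 (Or.inr (Or.inr rfl)) (Or.inr (Or.inl rfl)) (Or.inl hb) ?_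
  have hanchor : ClosedAnchor o a₁ a₂ b {e : E // e ≠ e₂}
      (restrictEnds (pairEnds ends P e₁ e₂ e₃ x w a₃ o) e₂) w :=
    Or.inr (Or.inr (Or.inr (Or.inr (hh.rootsAndOAnchor_hub hx h1 h2 hb))))
  have hmove : Moves o a₁ a₂ b {e : E // e ≠ e₂}
      (restrictEnds (pairEnds ends P e₁ e₂ e₃ x w a₃ o) e₂) w E
      (pairEnds ends P e₁ e₂ e₃ x w a₃ o) a₃ :=
    Moves.tail (Moves.refl _ _ _)
      (MoveStep.leafMove E (pairEnds ends P e₁ e₂ e₃ x w a₃ o) w a₃ e₂ hh.isLeafAt_hub hh.ne_z.symm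
        (fun h => h1 (h ▸ hh.mem_z₁)) (fun h => h2 (h ▸ hh.mem_z₁)) (fun h => hb (h ▸ hh.mem_z₁)))
  exact closedAt_of_moves_closedAnchor o a₁ a₂ b hanchor hmove

/-- `(J1₁)` at a statement vertex sharing a pocket at a root with the mark `o`. -/
theorem jOneOne_of_pair_at_root (hh : IsPairPocket ends W x P e₁ e₂ e₃ w a₃ o)
    (hx : x = a₁ ∨ x = a₂) (h1 : a₁ ∉ W) (h2 : a₂ ∉ W) (hb : b ∉ W) (p : E → R) (hp : IsProbVec p) :
    JOneOne p ends o a₁ a₂ a₃ b :=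
  jOneOne_of_i_of_ii p ends o a₁ a₂ a₃ b (closedAt_of_pair_at_root hh hx h1 h2 hb p hp).2.2.1
    (closedAt_of_pair_at_root hh hx h1 h2 hb p hp).1

end PairRoot

end CaseOne

end Summit.Ventures.PercRepro2
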